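import Literature.MathematicalPhysics.QuantumLattice.DWaveSourceNNNHopping
import Literature.MathematicalPhysics.QuantumLattice.PairFieldMomentum
import Literature.MathematicalPhysics.QuantumLattice.HubbardRectangularTorus
import Literature.MathematicalPhysics.QuantumLattice.HubbardNNNHopping
import Literature.MathematicalPhysics.QuantumLattice.GriffithsLemmaGroundStates
import Literature.MathematicalPhysics.QuantumLattice.FinDimSpectrumSectorGibbsLimit
import Literature.Barriers.HubbardSuperconductivity.HohenbergMerminWagnerPairing
import HarnessLib

/-!
# FQ2 (exact small-torus arm) — SECTOR ROWS for pair-sourced Hubbard clusters: objects, cells, and the solver-free chord edges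

Cell hubbard-floor (D-0160 FLOOR cell, brief BRIEF-HUBBARD-FLOOR v1.1 §1 FQ2; seat hubbard-floor-eng-2, PREREG
`pub/hubbard-floor/hubbard-floor-eng-2/PREREG-FQ2-proposal.md`). HONEST FRAMING: finite-volume exact-diagonalisation rows on 8- and
16-site tori; «m_Λ(h) ∈ [m⁻, m⁺] at h = …, CERTIFIED(…)»; a response at fixed `h > 0` on a finite torus is symmetry-allowed and is NOT an
order parameter; no «onset», «gap», «Tc», «order» words; superconductivity in the Hubbard model is not proved by any of this.

WHAT THIS FILE IS. The instrument's CONTROL arm compares the canonical class `(U, t′, g) = (8, 0 | −¼, d-wave)` with the attractive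
control `(−8, 0, s-wave)` on the tori `Λ8 = ℤ/4 × ℤ/2` (`fermionRectTorusGraph 4 2`, 12 NN edges, the rung counted ONCE as in mbsolver
`#19`) and `Λ16 = (ℤ/4)²` (`fermionTorusGraph 2 4`), in a fixed `S^z = M` eigenspace of the FULL Fock space (`fockSpinZSector M`; the
source breaks `U(1)` to fermion parity, and `2M mod 2` fixes the parity). The certified ED codes deliver, per field `h`, a bracket of the
SECTOR ground energy and a bracket of `Re ⟨ψ, (Δ_g + Δ_g†) ψ⟩` over every unit sector ground state `ψ`; this file types the language:

* §1 OBJECTS (tree normalisation `Δ_g = pairField g`, i.e. `√2·Σ_edges s_e b_e` for `d`-wave and `√2·Σ_x c_{x↑}c_{x↓}` for on-site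
  `s`-wave): `pairSourceTorusTT' g L tp U μ h = hubbardTorusTT' L 1 tp U − μN − h(Δ_g + Δ_g†)` (so `pairSourceTorusTT' dWaveFormFactor =
  dWaveSourceTorusTT'`, `pairSourceTorusTT'_dWave`), the rectangular-torus `d`-wave weight / pair field `rectTorusDWavePairField a b =
  Σ_{p,q} w(p,q) • bondPair p q` (`w = ±1/√2` on x- resp. y-edges of `fermionRectTorusGraph a b`, each edge met from both ends), the on-site
  `s`-wave pair field `onsitePairField Λ = √2·Σ_x c_{x↑}c_{x↓}` on any finite `Λ`, and `rectTorusSourced a b Δ tp U μ h =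
  hubbardRectTorusTT' a b 1 tp U − μN − h(Δ + Δᴴ)`.
* §2 CELLS (statements, never asserted here): `SectorEnergyCell K M lo hi` (`lo ≤ minEnergyOn K (fockSpinZSector M) ≤ hi`) and
  `SectorGroundObsCell K X M lo hi` (every unit `ψ ∈ fockSpinZSector M` realising `minEnergyOn` has `lo ≤ Re⟨ψ, Xψ⟩ ≤ hi`).
* §3 SOLVER-FREE EDGES (proved): monotonic weakening of both cells, and the Hellmann–Feynman/Griffiths CHORDS — for the pencil
  `h ↦ H₀ − h•Y` and a sector ground state `ψ` at field `h`: `e(h₁) ≤ e(h) + (h − h₁)·Re⟨ψ,Yψ⟩` for every `h₁`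
  (`sectorEnergy_le_add_of_ground`), hence `(lo₁ − hi)/(h − h₁) ≤ Re⟨ψ,Yψ⟩` from cells at `h₁ < h` and `Re⟨ψ,Yψ⟩ ≤ (hi − lo₂)/(h₂ − h)`
  from cells at `h < h₂` (`SectorGroundObsCell.of_energyCells_left/right`) — the tree's `minEnergyOn_pencil_le_of_ground`
  (`GriffithsLemmaGroundStates`).

Nothing is asserted; cells are instantiated under `Certificates/` from the ED deposits (two independent codes, exact rationals / `ℚ(√2)`).
References: T. Koma, H. Tasaki, J. Stat. Phys. 76 (1994) 745 §1 (order operator with a symmetry-breaking source; finite-volume order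
parameters); T. Kennedy, E. H. Lieb, B. S. Shastry, J. Stat. Phys. 53 (1988) 1019 (finite-volume order-parameter inequalities);
R. B. Griffiths, Phys. Rev. 152 (1966) 240 §II (chords of a concave ground energy); E. Dagotto, Rev. Mod. Phys. 66 (1994) 763 §III
(exact diagonalisation of Hubbard clusters on `√8×√8`, `4×4` tori).
-/

noncomputable section

namespace Summit.Ventures.CertifiedManyBodySolver

open Literature.MathematicalPhysics.QuantumLattice Literature.Barriers.HubbardSuperconductivity
open Matrix HubbardWave0 Literature.Probability.LatticeModels Finset
open scoped BigOperators ComplexOrder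

/-! ## §1  Objects -/

section Objects

/-- **Pair-sourced `t–t'` Hubbard torus with a general form factor `g`**: `hubbardTorusTT' L 1 tp U − μ N − h (Δ_g + Δ_g†)`,
`Δ_g = pairField g L` (tree normalisation). [cite: KomaTasaki1994, §1] -/
def pairSourceTorusTT' (g : Site 2 → ℝ) (L : ℕ) [NeZero L] (tp U μ h : ℝ) :
    Matrix (Finset (Orb (FermionTorus 2 L))) (Finset (Orb (FermionTorus 2 L))) ℂ :=
  hubbardTorusTT' L 1 tp U - (μ : ℂ) • totalNumber - (h : ℂ) • (pairField g L + (pairField g L)ᴴ)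

/-- With the `d_{x²−y²}` form factor the general object is the tree's `dWaveSourceTorusTT'`. [cite: KomaTasaki1994, §1] -/
@[simp] theorem pairSourceTorusTT'_dWave (L : ℕ) [NeZero L] (tp U μ h : ℝ) :
    pairSourceTorusTT' dWaveFormFactor L tp U μ h = dWaveSourceTorusTT' L tp U μ h := rfl

/-- At `h = 0` the source drops out. [folklore] -/
@[simp] theorem pairSourceTorusTT'_zero_field (g : Site 2 → ℝ) (L : ℕ) [NeZero L] (tp U μ : ℝ) :
    pairSourceTorusTT' g L tp U μ 0 = hubbardTorusTT' L 1 tp U - (μ : ℂ) • totalNumber := by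
  simp [pairSourceTorusTT']

/-- The `d`-wave pair WEIGHT on the rectangular torus `ℤ/aℤ × ℤ/bℤ` (ordered pairs of `fermionRectTorusGraph a b`): `+1/√2` on an edge along the
first coordinate (equal second coordinates), `−1/√2` on an edge along the second coordinate, `0` off the graph. Each (unordered) edge is met from
both ends, so `Σ_{p,q} w(p,q)·b_{pq} = √2·Σ_edges s_e b_e` (`b_{pq} = b_{qp}`) — the tree's `pairField dWaveFormFactor` normalisation; on a side of
length `2` the ring has ONE edge per pair (simple graph, mbsolver row #19 convention). [cite: Scalapino1995, §2] -/
def rectTorusDWaveWeight (a b : ℕ) (p q : Fin a ×ₗ Fin b) : ℝ :=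
  if (fermionRectTorusGraph a b).Adj p q then (if (ofLex p).2 = (ofLex q).2 then 1 else -1) / Real.sqrt 2 else 0

/-- The `d`-wave pair field of the rectangular torus: `Δ_d^{a×b} = Σ_{p,q} w(p,q) • b_{pq}`, `b_{pq} = c_{p↑}c_{q↓} − c_{p↓}c_{q↑}` (`bondPair`).
[cite: Scalapino1995, §2] -/
def rectTorusDWavePairField (a b : ℕ) : Matrix (Finset (Orb (Fin a ×ₗ Fin b))) (Finset (Orb (Fin a ×ₗ Fin b))) ℂ :=
  ∑ p : Fin a ×ₗ Fin b, ∑ q : Fin a ×ₗ Fin b, ((rectTorusDWaveWeight a b p q : ℝ) : ℂ) • bondPair p q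

/-- The on-site `s`-wave pair field in the tree's `pairField sWave` normalisation on any finite site set: `Δ_s = √2·Σ_x c_{x↑} c_{x↓}`
(`localPair sWave` at `e = 0` reads `(1/√2)(c_{x↑}c_{x↓} − c_{x↓}c_{x↑}) = √2·c_{x↑}c_{x↓}`). [cite: Scalapino1995, §2] -/
def onsitePairField (Λ : Type*) [LinearOrder Λ] [Fintype Λ] : Matrix (Finset (Orb Λ)) (Finset (Orb Λ)) ℂ :=
  ∑ x : Λ, ((Real.sqrt 2 : ℝ) : ℂ) • (annihilation (orb x 0) * annihilation (orb x 1))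

/-- **Pair-sourced `t–t'` Hubbard model on the rectangular torus** with an arbitrary pair field `Δ`:
`hubbardRectTorusTT' a b 1 tp U − μ N − h (Δ + Δᴴ)`. [cite: KomaTasaki1994, §1] -/
def rectTorusSourced (a b : ℕ) (Δ : Matrix (Finset (Orb (Fin a ×ₗ Fin b))) (Finset (Orb (Fin a ×ₗ Fin b))) ℂ) (tp U μ h : ℝ) :
    Matrix (Finset (Orb (Fin a ×ₗ Fin b))) (Finset (Orb (Fin a ×ₗ Fin b))) ℂ :=
  hubbardRectTorusTT' a b 1 tp U - (μ : ℂ) • totalNumber - (h : ℂ) • (Δ + Δᴴ)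

/-- At `h = 0` the source drops out. [folklore] -/
@[simp] theorem rectTorusSourced_zero_field (a b : ℕ) (Δ : Matrix (Finset (Orb (Fin a ×ₗ Fin b))) (Finset (Orb (Fin a ×ₗ Fin b))) ℂ)
    (tp U μ : ℝ) : rectTorusSourced a b Δ tp U μ 0 = hubbardRectTorusTT' a b 1 tp U - (μ : ℂ) • totalNumber := by
  simp [rectTorusSourced]

/-- A sourced family is a PENCIL in the field: `K(h) = K(0) + h • (−(Δ + Δᴴ))` (rectangular torus). [folklore] -/
theorem rectTorusSourced_eq_pencil (a b : ℕ) (Δ : Matrix (Finset (Orb (Fin a ×ₗ Fin b))) (Finset (Orb (Fin a ×ₗ Fin b))) ℂ)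
    (tp U μ h : ℝ) :
    rectTorusSourced a b Δ tp U μ h = rectTorusSourced a b Δ tp U μ 0 + (h : ℂ) • (-(Δ + Δᴴ)) := by
  simp [rectTorusSourced, smul_neg, sub_eq_add_neg]

/-- A sourced family is a PENCIL in the field: `K(h) = K(0) + h • (−(Δ_g + Δ_g†))` (square torus). [folklore] -/
theorem pairSourceTorusTT'_eq_pencil (g : Site 2 → ℝ) (L : ℕ) [NeZero L] (tp U μ h : ℝ) :
    pairSourceTorusTT' g L tp U μ h = pairSourceTorusTT' g L tp U μ 0 + (h : ℂ) • (-(pairField g L + (pairField g L)ᴴ)) := by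
  simp [pairSourceTorusTT', smul_neg, sub_eq_add_neg]

/-- The rectangular sourced object is Hermitian at every field. [folklore] -/
theorem rectTorusSourced_isHermitian (a b : ℕ) (Δ : Matrix (Finset (Orb (Fin a ×ₗ Fin b))) (Finset (Orb (Fin a ×ₗ Fin b))) ℂ)
    (tp U μ h : ℝ) : (rectTorusSourced a b Δ tp U μ h).IsHermitian := by
  unfold rectTorusSourced
  refine ((hubbardRectTorusTT'_isHermitian a b 1 tp U).sub (IsHermitian.smul totalNumber_isHermitian ?_)).sub
    (IsHermitian.smul (isHermitian_add_transpose_self Δ) ?_)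
  · rw [isSelfAdjoint_iff, Complex.star_def, Complex.conj_ofReal]
  · rw [isSelfAdjoint_iff, Complex.star_def, Complex.conj_ofReal]

/-- The general pair-sourced square-torus object is Hermitian at every field. [folklore] -/
theorem pairSourceTorusTT'_isHermitian (g : Site 2 → ℝ) (L : ℕ) [NeZero L] (tp U μ h : ℝ) :
    (pairSourceTorusTT' g L tp U μ h).IsHermitian := by
  unfold pairSourceTorusTT'
  refine ((hubbardTorusTT'_isHermitian L 1 tp U).sub (IsHermitian.smul totalNumber_isHermitian ?_)).sub
    (IsHermitian.smul (isHermitian_add_transpose_self _) ?_)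
  · rw [isSelfAdjoint_iff, Complex.star_def, Complex.conj_ofReal]
  · rw [isSelfAdjoint_iff, Complex.star_def, Complex.conj_ofReal]

end Objects

/-! ## §2  Cells (statements; nothing asserted here) -/

section Cells

variable {Λ : Type*} [LinearOrder Λ] [Fintype Λ]

/-- **SECTOR ENERGY CELL.** `lo ≤ e_M(K) ≤ hi` for the sector energy `e_M(K) = minEnergyOn K (fockSpinZSector M)` = the infimum of
`Re ⟨ψ, Kψ⟩` over unit vectors of the `S^z = M` eigenspace of the full Fock space (the lowest eigenvalue of `K` restricted to that invariant
subspace when `K` is Hermitian and commutes with `S^z`). Rational slots. [cite: KomaTasaki1994, §1] -/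
def SectorEnergyCell (K : Matrix (Finset (Orb Λ)) (Finset (Orb Λ)) ℂ) (M : ℝ) (lo hi : ℚ) : Prop :=
  ((lo : ℝ) ≤ K.minEnergyOn (fockSpinZSector M)) ∧ (K.minEnergyOn (fockSpinZSector M) ≤ ((hi : ℚ) : ℝ))

/-- **SECTOR GROUND-STATE OBSERVABLE CELL.** Every unit vector `ψ` of the `S^z = M` eigenspace that realises the sector energy of `K`
(`Re⟨ψ,Kψ⟩ = e_M(K)`, i.e. every sector ground state) has `lo ≤ Re ⟨ψ, X ψ⟩ ≤ hi`. Rational slots. [cite: KomaTasaki1994, §1] -/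
def SectorGroundObsCell (K X : Matrix (Finset (Orb Λ)) (Finset (Orb Λ)) ℂ) (M : ℝ) (lo hi : ℚ) : Prop :=
  ∀ ψ : Fock (Orb Λ), ψ ∈ fockSpinZSector M → star ψ ⬝ᵥ ψ = 1 →
    (star ψ ⬝ᵥ K *ᵥ ψ).re = K.minEnergyOn (fockSpinZSector M) →
      ((lo : ℝ) ≤ (star ψ ⬝ᵥ X *ᵥ ψ).re) ∧ ((star ψ ⬝ᵥ X *ᵥ ψ).re ≤ ((hi : ℚ) : ℝ))

/-- Weakening of an energy cell. [folklore] -/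
theorem SectorEnergyCell.mono {K : Matrix (Finset (Orb Λ)) (Finset (Orb Λ)) ℂ} {M : ℝ} {lo hi lo' hi' : ℚ}
    (h : SectorEnergyCell K M lo hi) (hlo : lo' ≤ lo) (hhi : hi ≤ hi') : SectorEnergyCell K M lo' hi' :=
  ⟨le_trans (by exact_mod_cast hlo) h.1, le_trans h.2 (by exact_mod_cast hhi)⟩

/-- An energy cell has ordered slots. [folklore] -/
theorem SectorEnergyCell.lo_le_hi {K : Matrix (Finset (Orb Λ)) (Finset (Orb Λ)) ℂ} {M : ℝ} {lo hi : ℚ}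
    (h : SectorEnergyCell K M lo hi) : lo ≤ hi := by
  have := le_trans h.1 h.2; exact_mod_cast this

/-- Weakening of an observable cell. [folklore] -/
theorem SectorGroundObsCell.mono {K X : Matrix (Finset (Orb Λ)) (Finset (Orb Λ)) ℂ} {M : ℝ} {lo hi lo' hi' : ℚ}
    (h : SectorGroundObsCell K X M lo hi) (hlo : lo' ≤ lo) (hhi : hi ≤ hi') : SectorGroundObsCell K X M lo' hi' := by
  intro ψ hψ h1 hg
  obtain ⟨h₁, h₂⟩ := h ψ hψ h1 hg
  exact ⟨le_trans (by exact_mod_cast hlo) h₁, le_trans h₂ (by exact_mod_cast hhi)⟩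

end Cells

/-! ## §3  Solver-free edges: the Griffiths / Hellmann–Feynman chords on a sector -/

section Chords

variable {n : Type*} [Fintype n] [DecidableEq n]

/-- **Supergradient inequality for the pencil `h ↦ H₀ − h•Y` on a sector `S`.** If `ψ ∈ S` is a unit sector ground state at field `h`
(`Re⟨ψ,(H₀ − hY)ψ⟩ = e(h)`), then for every `h₁`: `e(h₁) ≤ e(h) + (h − h₁)·Re⟨ψ, Yψ⟩` (ψ as a trial state at `h₁`). This is the tree's
`minEnergyOn_pencil_le_of_ground` for the pencil `H₀ + t•(−Y)`. [cite: Griffiths1966, §II] -/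
theorem sectorEnergy_le_add_of_ground {H₀ Y : Matrix n n ℂ} (hH : H₀.IsHermitian) (hY : Y.IsHermitian) (S : Submodule ℂ (n → ℂ))
    {h : ℝ} {ψ : n → ℂ} (hψS : ψ ∈ S) (hψ : star ψ ⬝ᵥ ψ = 1)
    (hground : (star ψ ⬝ᵥ (H₀ + (h : ℂ) • (-Y)) *ᵥ ψ).re = (H₀ + (h : ℂ) • (-Y)).minEnergyOn S) (h₁ : ℝ) :
    (H₀ + (h₁ : ℂ) • (-Y)).minEnergyOn S ≤ (H₀ + (h : ℂ) • (-Y)).minEnergyOn S + (h - h₁) * (star ψ ⬝ᵥ Y *ᵥ ψ).re := by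
  have key := minEnergyOn_pencil_le_of_ground hH hY.neg S hψS hψ hground h₁
  have hneg : (star ψ ⬝ᵥ (-Y) *ᵥ ψ).re = -(star ψ ⬝ᵥ Y *ᵥ ψ).re := by
    rw [neg_mulVec, dotProduct_neg, Complex.neg_re]
  rw [hneg] at key
  linarith

/-- **Left chord.** From an energy FLOOR `lo₁ ≤ e(h₁)` at a smaller field `h₁ < h` and an energy CEILING `e(h) ≤ hi` at `h`, every unit sector
ground state `ψ` at `h` obeys `(lo₁ − hi)/(h − h₁) ≤ Re⟨ψ, Yψ⟩`. [cite: Griffiths1966, §II] -/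
theorem re_ground_ge_left_chord {H₀ Y : Matrix n n ℂ} (hH : H₀.IsHermitian) (hY : Y.IsHermitian) (S : Submodule ℂ (n → ℂ))
    {h₁ h : ℝ} (hlt : h₁ < h) {lo₁ hi : ℝ}
    (hlo : lo₁ ≤ (H₀ + (h₁ : ℂ) • (-Y)).minEnergyOn S) (hhi : (H₀ + (h : ℂ) • (-Y)).minEnergyOn S ≤ hi)
    {ψ : n → ℂ} (hψS : ψ ∈ S) (hψ : star ψ ⬝ᵥ ψ = 1)
    (hground : (star ψ ⬝ᵥ (H₀ + (h : ℂ) • (-Y)) *ᵥ ψ).re = (H₀ + (h : ℂ) • (-Y)).minEnergyOn S) :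
    (lo₁ - hi) / (h - h₁) ≤ (star ψ ⬝ᵥ Y *ᵥ ψ).re := by
  have key := sectorEnergy_le_add_of_ground hH hY S hψS hψ hground h₁
  rw [div_le_iff₀ (by linarith)]
  nlinarith

/-- **Right chord.** From an energy CEILING `e(h) ≤ hi` at `h` and an energy FLOOR `lo₂ ≤ e(h₂)` at a larger field `h < h₂`, every unit
sector ground state `ψ` at `h` obeys `Re⟨ψ, Yψ⟩ ≤ (hi − lo₂)/(h₂ − h)`. [cite: Griffiths1966, §II] -/
theorem re_ground_le_right_chord {H₀ Y : Matrix n n ℂ} (hH : H₀.IsHermitian) (hY : Y.IsHermitian) (S : Submodule ℂ (n → ℂ))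
    {h h₂ : ℝ} (hlt : h < h₂) {hi lo₂ : ℝ}
    (hhi : (H₀ + (h : ℂ) • (-Y)).minEnergyOn S ≤ hi) (hlo : lo₂ ≤ (H₀ + (h₂ : ℂ) • (-Y)).minEnergyOn S)
    {ψ : n → ℂ} (hψS : ψ ∈ S) (hψ : star ψ ⬝ᵥ ψ = 1)
    (hground : (star ψ ⬝ᵥ (H₀ + (h : ℂ) • (-Y)) *ᵥ ψ).re = (H₀ + (h : ℂ) • (-Y)).minEnergyOn S) :
    (star ψ ⬝ᵥ Y *ᵥ ψ).re ≤ (hi - lo₂) / (h₂ - h) := by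
  have key := sectorEnergy_le_add_of_ground hH hY S hψS hψ hground h₂
  rw [le_div_iff₀ (by linarith)]
  nlinarith

end Chords

end Summit.Ventures.CertifiedManyBodySolver

end
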